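import Literature.Combinatorics.LorentzianPolynomials.Substitution
import HarnessLib

/-!
# Restricting a Lorentzian polynomial to two of its variables: the coefficients along any line of `Δ^d_n` form an
# ultra log-concave sequence with no internal zeros (Brändén–Huh 2020, Thm. 2.10 + Example 2.26; proof of Prop. 4.4)

Layer `Literature/Combinatorics/LorentzianPolynomials`, namespace `Literature.Combinatorics.LorentzianPolynomials`;
lane `lit-hodgefound` (Track 2 foundations library), seat p16, generation 27 (row g27-#9). Sequel of `Substitution.lean`
(row g27-#8: `diagScale_mem_lorentzian` — setting variables to zero keeps a polynomial Lorentzian; `rename_mem_lorentzian`),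
`Bivariate.lean` (row g27-#6: Example 2.26, `bivariate_mem_lorentzian_iff`) and `Quadratic.lean` (row g27-#7: Theorem 2.25 as
the criterion `mem_lorentzian_iff_forall_sigPos_normCoeff`).

## Source (verbatim) — P. Brändén, J. Huh, *Lorentzian polynomials* [BrandenHuh2019] (held `paper:arxiv-1902.03719`)

* §2.2 **Theorem 2.10**: "If `f(w) ∈ L^d_n`, then `f(Av) ∈ L^d_m` for any `n × m` matrix `A` with nonnegative entries."
* §2.4 **Example 2.26**: "a bivariate homogeneous polynomial `Σ_{k=0}^d a_k w_1^k w_2^{d-k}` is Lorentzian if and only if the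
  sequence `a_k` is nonnegative, ultra log-concave, and has no internal zeros."
* §4.1 proof of **Proposition 4.4**: "Consider the Lorentzian polynomial `∂^{α-e_i-e_j} f`. Substituting `w_k` by zero for all `k`
  other than `i` and `j`, we get the bivariate quadratic polynomial […]"; §4.3 proof of Theorem 4.14: "by Theorem 2.10, the
  bivariate polynomial obtained from `f_M` by setting `w_1 = ⋯ = w_n` is Lorentzian. The conclusion follows from the fact that
  a bivariate homogeneous polynomial with nonnegative coefficients is Lorentzian if and only if the sequence of coefficients
  form an ultra log-concave sequence with no internal zeros."

## What is here

* §1 **`mem_lorentzian_iff_rename`**: for an injective relabeling `ι : σ → τ`, `f ∈ L^d_σ ⟺ rename ι f ∈ L^d_τ` (the converse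
  of row g27-#8's `rename_mem_lorentzian`: pull the support and the Hessian-type matrices back along `ι`);
  `IsMConvex.of_image_mapDomain`.
* §2 the two-variable restriction: `pair i j = (i, j) : Fin 2 → σ`, `rename_pair_bivariate` (for homogeneous `f`,
  `rename (i, j) (Σ_k coeff_{k e_i + (d-k) e_j}(f) w_0^k w_1^{d-k}) = f|_{w_k = 0, k ≠ i, j}`), **`bivariate_coeff_mem_lorentzian`**
  (`f ∈ L^d_n ⟹ Σ_k coeff_{k e_i + (d-k) e_j}(f) w_0^k w_1^{d-k} ∈ L^d_2`), and
  **`isUltraLogConcave_coeff_of_mem_lorentzian`**: for `f ∈ L^d_n` and `i ≠ j` the sequence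
  `a_k = coeff_{k e_i + (d-k) e_j}(f)`, `0 ≤ k ≤ d`, is ultra log-concave with no internal zeros.

Theorems and one definition with body (`pair`); no `sorry`, no named fact (net debt 0).

## References

* [BrandenHuh2019] P. Brändén, J. Huh, *Lorentzian polynomials*, Ann. of Math. (2) 192 (2020) 821–891, arXiv:1902.03719 —
  §2.2 Thm. 2.10; §2.4 Example 2.26; §4.1 proof of Prop. 4.4; §4.3 proof of Thm. 4.14.
-/

noncomputable section

open MvPolynomial Finsupp Finset
open scoped Nat

namespace Literature.Combinatorics.LorentzianPolynomials

variable {σ τ : Type*}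

/-! ## §1 `f ∈ L^d_σ ⟺ rename ι f ∈ L^d_τ` for injective `ι` -/

section RenameIff

/-- **M-convexity pulls back along an injective relabeling**: if `ι_*(J)` is M-convex then so is `J`.
[cite: BrandenHuh2019, §2.2 Thm. 2.10 (permutation / `0/1` matrix `A`); §2.2 (p. 11)] -/
theorem IsMConvex.of_image_mapDomain {J : Set (σ →₀ ℕ)} {ι : σ → τ} (hι : Function.Injective ι)
    (hJ : IsMConvex (Finsupp.mapDomain ι '' J)) : IsMConvex J := by
  classical
  intro α β hα hβ i hi
  obtain ⟨j', hj', hmem⟩ := hJ ⟨α, hα, rfl⟩ ⟨β, hβ, rfl⟩ (ι i)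
    (by rwa [Finsupp.mapDomain_apply hι, Finsupp.mapDomain_apply hι])
  obtain ⟨j, rfl⟩ : j' ∈ Set.range ι := by
    by_contra h
    rw [Finsupp.mapDomain_notin_range _ _ h, Finsupp.mapDomain_notin_range _ _ h] at hj'
    exact lt_irrefl _ hj'
  rw [Finsupp.mapDomain_apply hι, Finsupp.mapDomain_apply hι] at hj'
  refine ⟨j, hj', ?_⟩
  obtain ⟨γ, hγ, hγeq⟩ := hmem
  rw [← mapDomain_sub_single_add_single ι (by omega) j] at hγeq
  rwa [← Finsupp.mapDomain_injective hι hγeq]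

variable [Fintype σ] [Fintype τ] [DecidableEq σ] [DecidableEq τ]

omit [DecidableEq σ] in
/-- The sum over `τ` of a function vanishing off the image of an injective `ι` is the sum over `σ`. [folklore] -/
private theorem sum_eq_sum_image {ι : σ → τ} (hι : Function.Injective ι) (g : τ → ℝ)
    (hg : ∀ a, a ∉ Set.range ι → g a = 0) : ∑ a, g a = ∑ i, g (ι i) := by
  rw [← Finset.sum_subset (Finset.subset_univ (Finset.univ.image ι)) fun a _ ha ↦
    hg a fun ⟨i, hi⟩ ↦ ha (Finset.mem_image.2 ⟨i, Finset.mem_univ _, hi⟩), Finset.sum_image fun i _ j _ h ↦ hι h]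

/-- **`f ∈ L^d_σ ⟺ rename ι f ∈ L^d_τ` for an injective relabeling `ι`** (Theorem 2.10 for the `0/1` matrix of `ι` and
its transpose: a polynomial is Lorentzian iff it is Lorentzian as a polynomial in more variables). `⟸`: the support of
`f` is the pull-back of that of `rename ι f`, and `(c_{α+e_i+e_j}(f))_{ij}` is the pull-back of
`(c_{ι_*α+e_a+e_b}(rename ι f))_{ab}` along the extension-by-zero `x ↦ (a ↦ x_i if a = ι i, 0 otherwise)`.
[cite: BrandenHuh2019, §2.2 Thm. 2.10; §2.4 Thm. 2.25] -/
theorem mem_lorentzian_iff_rename {ι : σ → τ} (hι : Function.Injective ι) :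
    ∀ {d : ℕ} {f : MvPolynomial σ ℝ}, f ∈ lorentzian σ d ↔ rename ι f ∈ lorentzian τ d := by
  -- nonnegativity of coefficients pulls back
  have hnn_of : ∀ {f : MvPolynomial σ ℝ}, (∀ β, 0 ≤ coeff β (rename ι f)) → ∀ α, 0 ≤ coeff α f :=
    fun h α ↦ by rw [← coeff_rename_mapDomain ι hι]; exact h _
  intro d f
  refine ⟨rename_mem_lorentzian hι, fun hf ↦ ?_⟩
  match d, hf with
  | 0, hf => exact mem_lorentzian_zero.2 ⟨(IsHomogeneous.rename_isHomogeneous_iff hι).1 hf.1, hnn_of hf.2⟩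
  | 1, hf => exact mem_lorentzian_one.2 ⟨(IsHomogeneous.rename_isHomogeneous_iff hι).1 hf.1, hnn_of hf.2⟩
  | m + 2, hf =>
    obtain ⟨⟨hhom, hnn, hM⟩, hsig⟩ := mem_lorentzian_iff_forall_sigPos_normCoeff.1 hf
    refine mem_lorentzian_iff_forall_sigPos_normCoeff.2
      ⟨⟨(IsHomogeneous.rename_isHomogeneous_iff hι).1 hhom, hnn_of hnn, ?_⟩, fun α hα ↦ ?_⟩
    · rw [support_rename_of_injective hι] at hM
      exact hM.of_image_mapDomain hι
    · -- pull back along the extension by zero `E`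
      set E : (σ → ℝ) →ₗ[ℝ] (τ → ℝ) :=
        { toFun := fun x a ↦ ∑ i, if ι i = a then x i else 0
          map_add' := fun x y ↦ by
            ext a; simp only [Pi.add_apply, ← Finset.sum_add_distrib]
            exact Finset.sum_congr rfl fun i _ ↦ by split_ifs <;> simp
          map_smul' := fun r x ↦ by
            ext a; simp only [Pi.smul_apply, smul_eq_mul, RingHom.id_apply, Finset.mul_sum]
            exact Finset.sum_congr rfl fun i _ ↦ by split_ifs <;> simp } with hE
      have hEι : ∀ x i, E x (ι i) = x i := fun x i ↦ by
        simp only [hE, LinearMap.coe_mk, AddHom.coe_mk]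
        rw [Finset.sum_eq_single_of_mem i (Finset.mem_univ i) fun k _ hk ↦ if_neg (fun h ↦ hk (hι h)), if_pos rfl]
      have hE0 : ∀ x a, a ∉ Set.range ι → E x a = 0 := fun x a ha ↦ by
        simp only [hE, LinearMap.coe_mk, AddHom.coe_mk]
        exact Finset.sum_eq_zero fun i _ ↦ if_neg fun h ↦ ha ⟨i, h⟩
      have hd : (Finsupp.mapDomain ι α).degree = m := by rw [Finsupp.degree_mapDomain, hα]
      refine (LinearMap.BilinForm.sigPos_le_sigPos_of_comp _ _ E fun x y ↦ ?_).trans (hsig (Finsupp.mapDomain ι α) hd)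
      rw [Matrix.toBilin'_apply, Matrix.toBilin'_apply,
        sum_eq_sum_image hι _ (fun a ha ↦ by simp only [hE0 x a ha, zero_mul, Finset.sum_const_zero])]
      refine Finset.sum_congr rfl fun i _ ↦ ?_
      rw [sum_eq_sum_image hι _ (fun b hb ↦ by simp only [hE0 y b hb, mul_zero])]
      refine Finset.sum_congr rfl fun j _ ↦ ?_
      rw [Matrix.of_apply, Matrix.of_apply, hEι, hEι, ← Finsupp.mapDomain_single (f := ι) (a := i),
        ← Finsupp.mapDomain_single (f := ι) (a := j), ← Finsupp.mapDomain_add, ← Finsupp.mapDomain_add,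
        normCoeff_rename_mapDomain hι]

end RenameIff

/-! ## §2 The restriction to two variables and its coefficient sequence -/

section TwoVariables

/-- The pair `(i, j)` as a map `Fin 2 → σ` (the two kept variables). [cite: BrandenHuh2019, §4.1 proof of Prop. 4.4 ("for all `k`
other than `i` and `j`")] -/
def pair (i j : σ) : Fin 2 → σ := ![i, j]

/-- `(i, j)_0 = i`. [cite: BrandenHuh2019, §4.1 proof of Prop. 4.4] -/
@[simp] theorem pair_zero (i j : σ) : pair i j 0 = i := rfl

/-- `(i, j)_1 = j`. [cite: BrandenHuh2019, §4.1 proof of Prop. 4.4] -/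
@[simp] theorem pair_one (i j : σ) : pair i j 1 = j := rfl

/-- An index in two variables is `0` or `1`. [folklore] -/
private theorem fin_two_cases (a : Fin 2) : a = 0 ∨ a = 1 := by
  match a with
  | 0 => exact Or.inl rfl
  | 1 => exact Or.inr rfl

/-- `(i, j)` is injective for `i ≠ j`. [cite: BrandenHuh2019, §4.1 proof of Prop. 4.4] -/
theorem pair_injective {i j : σ} (hij : i ≠ j) : Function.Injective (pair i j) := by
  intro a b h
  rcases fin_two_cases a with rfl | rfl <;> rcases fin_two_cases b with rfl | rfl
  · rfl
  · exact absurd h hij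
  · exact absurd h.symm hij
  · rfl

/-- `(i, j)_* (k, l) = k e_i + l e_j`. [cite: BrandenHuh2019, §4.1 proof of Prop. 4.4] -/
theorem mapDomain_pair_bideg (i j : σ) (k l : ℕ) :
    Finsupp.mapDomain (pair i j) (bideg k l) = Finsupp.single i k + Finsupp.single j l := by
  rw [bideg, Finsupp.mapDomain_add, Finsupp.mapDomain_single, Finsupp.mapDomain_single, pair_zero, pair_one]

variable [Fintype σ] [DecidableEq σ]

omit [Fintype σ] in
/-- The indicator weights of `{i, j}`: `1` on `i`, `j`, `0` elsewhere. [cite: BrandenHuh2019, §4.1 proof of Prop. 4.4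
("Substituting `w_k` by zero for all `k` other than `i` and `j`")] -/
private theorem indicator_nonneg (i j : σ) (k : σ) : (0 : ℝ) ≤ if k = i ∨ k = j then 1 else 0 := by
  split_ifs <;> norm_num

/-- **The restriction to the variables `w_i, w_j` is the renamed bivariate form of the coefficients along the line
`{k e_i + (d-k) e_j}`**: for homogeneous `f` of degree `d` and `i ≠ j`,
`f|_{w_k = 0, k ≠ i, j} = rename (i, j) (Σ_k coeff_{k e_i + (d-k) e_j}(f) w_0^k w_1^{d-k})`.
[cite: BrandenHuh2019, §4.1 proof of Prop. 4.4; §2.4 Example 2.26] -/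
theorem rename_pair_bivariate {d : ℕ} {f : MvPolynomial σ ℝ} (hf : f.IsHomogeneous d) {i j : σ} (hij : i ≠ j) :
    rename (pair i j) (bivariate d fun k ↦ coeff (Finsupp.single i k + Finsupp.single j (d - k)) f) =
      diagScale (fun k ↦ if k = i ∨ k = j then 1 else 0) f := by
  classical
  have hι := pair_injective hij
  ext β
  rw [coeff_diagScale]
  by_cases hβ : β ∈ Set.range (Finsupp.mapDomain (pair i j) : (Fin 2 →₀ ℕ) → σ →₀ ℕ)
  · obtain ⟨γ, rfl⟩ := hβ
    rw [coeff_rename_mapDomain _ hι, coeff_bivariate]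
    -- the weight `Π_k c_k^{β_k}` is `1` on the image
    have hw : (∏ k, (if k = i ∨ k = j then (1 : ℝ) else 0) ^ (Finsupp.mapDomain (pair i j) γ) k) = 1 := by
      refine Finset.prod_eq_one fun k _ ↦ ?_
      by_cases hk : k = i ∨ k = j
      · rw [if_pos hk, one_pow]
      · rw [if_neg hk, Finsupp.mapDomain_notin_range _ _ ?_, pow_zero]
        rintro ⟨a, rfl⟩
        rcases fin_two_cases a with rfl | rfl
        · exact hk (Or.inl rfl)
        · exact hk (Or.inr rfl)
    rw [hw, one_mul]
    split_ifs with hdeg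
    · congr 1
      rw [eq_bideg γ, mapDomain_pair_bideg, bideg_apply_zero]
      have := degree_eq_add γ
      congr 2
      omega
    · symm
      exact hf.coeff_eq_zero (by rwa [Finsupp.degree_mapDomain])
  · rw [coeff_rename_eq_zero_of_not_mem_range _ hβ]
    -- some variable other than `i`, `j` occurs in `β`
    have hk : ∃ k, ¬ (k = i ∨ k = j) ∧ β k ≠ 0 := by
      by_contra h
      push Not at h
      apply hβ
      refine ⟨bideg (β i) (β j), ?_⟩
      rw [mapDomain_pair_bideg]
      ext k
      rw [Finsupp.add_apply, Finsupp.single_apply, Finsupp.single_apply]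
      by_cases hki : i = k
      · rw [if_pos hki, if_neg (fun hjk ↦ hij (hki.trans hjk.symm)), add_zero, hki]
      · by_cases hkj : j = k
        · rw [if_neg hki, if_pos hkj, zero_add, hkj]
        · rw [if_neg hki, if_neg hkj, add_zero]
          exact (h k ⟨fun e ↦ hki e.symm, fun e ↦ hkj e.symm⟩).symm
    obtain ⟨k, hk, hβk⟩ := hk
    rw [Finset.prod_eq_zero (Finset.mem_univ k) (by rw [if_neg hk, zero_pow hβk]), zero_mul]

/-- **Two-variable restrictions of Lorentzian polynomials are Lorentzian bivariate forms**: for `f ∈ L^d_n` and `i ≠ j`,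
`Σ_k coeff_{k e_i + (d-k) e_j}(f) w_0^k w_1^{d-k} ∈ L^d_2` (set `w_k = 0` for `k ≠ i, j` — Theorem 2.10 — and read the
result in the two variables `w_i, w_j`). [cite: BrandenHuh2019, §2.2 Thm. 2.10; §4.1 proof of Prop. 4.4] -/
theorem bivariate_coeff_mem_lorentzian {d : ℕ} {f : MvPolynomial σ ℝ} (hf : f ∈ lorentzian σ d) {i j : σ} (hij : i ≠ j) :
    bivariate d (fun k ↦ coeff (Finsupp.single i k + Finsupp.single j (d - k)) f) ∈ lorentzian (Fin 2) d := by
  rw [mem_lorentzian_iff_rename (pair_injective hij), rename_pair_bivariate (isHomogeneous_of_mem_lorentzian hf) hij]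
  exact diagScale_mem_lorentzian (indicator_nonneg i j) hf

/-- **The coefficients of a Lorentzian polynomial along any line `{k e_i + (d-k) e_j : 0 ≤ k ≤ d}` of `Δ^d_n` form an
ultra log-concave sequence with no internal zeros** (`i ≠ j`): Theorem 2.10 (restriction to `w_i, w_j`) followed by
Example 2.26. [cite: BrandenHuh2019, §2.4 Example 2.26; §2.2 Thm. 2.10; §4.1 proof of Prop. 4.4; §4.3 proof of Thm. 4.14
(the same two steps)] -/
theorem isUltraLogConcave_coeff_of_mem_lorentzian {d : ℕ} {f : MvPolynomial σ ℝ} (hf : f ∈ lorentzian σ d) {i j : σ}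
    (hij : i ≠ j) :
    IsUltraLogConcave d (fun k ↦ coeff (Finsupp.single i k + Finsupp.single j (d - k)) f) ∧
      HasNoInternalZeros d (fun k ↦ coeff (Finsupp.single i k + Finsupp.single j (d - k)) f) :=
  (bivariate_mem_lorentzian_iff fun _ _ ↦ coeff_nonneg_of_mem_lorentzian hf _).1 (bivariate_coeff_mem_lorentzian hf hij)

end TwoVariables

end Literature.Combinatorics.LorentzianPolynomials

end
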